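import Mathlib
import Literature.Analysis.Calculus.ClosedSubgroupExpChart
import HarnessLib

/-!
# The tubular chart `(X, A) ↦ exp X · (1 + A)` of a closed linear group

Let `𝔸` be a finite-dimensional real Banach algebra, `H ⊆ 𝔸` a subgroup of its units closed in
`𝔸`, `𝔥 = {X | exp(ℝX) ⊆ H}` its Lie algebra (a subspace: von Neumann 1929, tree file
`ClosedSubgroupExpChart`) and `𝔨` any linear complement of `𝔥` in `𝔸`. Everything here is PROVED;
there are no definitions and no named facts.

* `hasStrictFDerivAt_expMulOneAdd` — the map `Ψ(X, A) = exp X · (1 + A)` on `𝔥 × 𝔨` has strict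
  derivative `(X, A) ↦ X + A` at `0`, a linear isomorphism `𝔥 × 𝔨 ≃ 𝔸`;
* `analyticAt_expMulOneAdd` — `Ψ` is real-analytic;
* `exists_tubularChart` — hence (inverse function theorem, analytic version) `Ψ` is an analytic
  local diffeomorphism at `0 ↦ 1` with analytic inverse, and — this is where the closed-subgroup
  theorem enters — there is `r > 0` such that the representation `M = h (1 + A)`, `h ∈ H`, `A ∈ 𝔨`,
  `‖A‖ < r`, is UNIQUE: `h(1 + A) = h'(1 + A')` forces `h = h'`, `A = A'` (if `u = h'⁻¹h ∈ H` is
  close to `1` it is `exp X` with `X ∈ 𝔥` small, and `Ψ(X, A) = Ψ(0, A')` with both points in the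
  chart forces `X = 0`).

This is the standard "`H` is an embedded submanifold, with tubular neighbourhood `H · (1 + 𝔨_r)`"
statement for linear groups (Hall, *Lie Groups, Lie Algebras, and Representations*, 2nd ed.,
Cor. 3.45 of Thm. 3.42; Rossmann, *Lie Groups*, §2.7), in the multiplicative normal form adapted to
Haar measure: left translation by `H` permutes the fibres `h(1 + 𝔨_r)`, which is what turns Haar
integrals over compact linear groups into Euclidean integrals over the tube
(`ClosedSubgroupTubularMaps.lean`, and the Wilson-action application in
`MathematicalPhysics/QuantumFieldTheory/WilsonPartitionRegularVariationProofs.lean`).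

## References

* B. C. Hall, *Lie Groups, Lie Algebras, and Representations*, GTM 222, 2nd ed. (2015), Thm. 3.42,
  Cor. 3.44, Cor. 3.45. [Hall2015]
* J. von Neumann, Math. Z. 30 (1929) 3–42, §3. [vonNeumann1929]
-/

noncomputable section

open NormedSpace Filter Topology Set Metric

namespace Literature.Analysis.Calculus

section TubularChart

variable {𝔸 : Type*} [NormedRing 𝔸] [NormedAlgebra ℝ 𝔸] [CompleteSpace 𝔸]
  (𝔥 𝔨 : Submodule ℝ 𝔸)

/-- **The derivative of `Ψ(X, A) = exp X · (1 + A)` at `0` is `(X, A) ↦ X + A`.** [folklore] -/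
theorem hasStrictFDerivAt_expMulOneAdd :
    HasStrictFDerivAt (fun p : 𝔥 × 𝔨 => exp (p.1 : 𝔸) * (1 + (p.2 : 𝔸)))
      ((𝔥.subtypeL.comp (ContinuousLinearMap.fst ℝ 𝔥 𝔨)) +
        (𝔨.subtypeL.comp (ContinuousLinearMap.snd ℝ 𝔥 𝔨))) 0 := by
  have h1 : HasStrictFDerivAt (fun p : 𝔥 × 𝔨 => (p.1 : 𝔸))
      (𝔥.subtypeL.comp (ContinuousLinearMap.fst ℝ 𝔥 𝔨)) 0 :=
    (𝔥.subtypeL.comp (ContinuousLinearMap.fst ℝ 𝔥 𝔨)).hasStrictFDerivAt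
  have h2 : HasStrictFDerivAt (fun p : 𝔥 × 𝔨 => (1 : 𝔸) + (p.2 : 𝔸))
      (𝔨.subtypeL.comp (ContinuousLinearMap.snd ℝ 𝔥 𝔨)) 0 :=
    ((𝔨.subtypeL.comp (ContinuousLinearMap.snd ℝ 𝔥 𝔨)).hasStrictFDerivAt).const_add 1
  have he : HasStrictFDerivAt (exp : 𝔸 → 𝔸) (1 : 𝔸 →L[ℝ] 𝔸)
      ((fun p : 𝔥 × 𝔨 => (p.1 : 𝔸)) 0) := by
    simp only [Prod.fst_zero, ZeroMemClass.coe_zero]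
    exact hasStrictFDerivAt_exp_zero
  have hexp := he.comp (0 : 𝔥 × 𝔨) h1
  have hmul := hexp.mul' h2
  simp only [Prod.fst_zero, ZeroMemClass.coe_zero, exp_zero, Prod.snd_zero, add_zero,
    one_smul] at hmul
  have key : HasStrictFDerivAt (fun p : 𝔥 × 𝔨 => exp (p.1 : 𝔸) * (1 + (p.2 : 𝔸))) _ 0 := hmul
  refine key.congr_fderiv ?_
  ext p <;> simp [add_comm]

/-- `Ψ(X, A) = exp X · (1 + A)` is real-analytic on `𝔥 × 𝔨`. [folklore] -/
theorem analyticAt_expMulOneAdd (p : 𝔥 × 𝔨) :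
    AnalyticAt ℝ (fun p : 𝔥 × 𝔨 => exp (p.1 : 𝔸) * (1 + (p.2 : 𝔸))) p := by
  have h1 : AnalyticAt ℝ (fun p : 𝔥 × 𝔨 => (p.1 : 𝔸)) p :=
    (𝔥.subtypeL.comp (ContinuousLinearMap.fst ℝ 𝔥 𝔨)).analyticAt p
  have h2 : AnalyticAt ℝ (fun p : 𝔥 × 𝔨 => (1 : 𝔸) + (p.2 : 𝔸)) p :=
    analyticAt_const.add ((𝔨.subtypeL.comp (ContinuousLinearMap.snd ℝ 𝔥 𝔨)).analyticAt p)
  have h3 := AnalyticAt.comp (f := fun q : 𝔥 × 𝔨 => (q.1 : 𝔸)) (exp_analytic (𝕂 := ℝ) _) h1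
  have h4 : AnalyticAt ℝ (fun p : 𝔥 × 𝔨 => exp (p.1 : 𝔸) * (1 + (p.2 : 𝔸))) p := h3.mul h2
  exact h4

end TubularChart

section Main

variable {𝔸 : Type*} [NormedRing 𝔸] [NormedAlgebra ℚ 𝔸] [NormedAlgebra ℝ 𝔸] [CompleteSpace 𝔸]
  {H : Set 𝔸}

omit [NormedAlgebra ℚ 𝔸] [NormedAlgebra ℝ 𝔸] [CompleteSpace 𝔸] in
/-- In a multiplicatively closed set with left inverses, left inverses are two-sided. [folklore] -/
theorem mul_eq_one_comm_of_mem (hinv : ∀ a ∈ H, ∃ b ∈ H, b * a = 1) {a b : 𝔸}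
    (hb : b ∈ H) (hba : b * a = 1) : a * b = 1 := by
  obtain ⟨c, -, hcb⟩ := hinv b hb
  have : c = a := by
    calc c = c * (b * a) := by rw [hba, mul_one]
      _ = (c * b) * a := by rw [mul_assoc]
      _ = a := by rw [hcb, one_mul]
  rw [← this, hcb]

omit [NormedAlgebra ℚ 𝔸] [NormedAlgebra ℝ 𝔸] in
/-- The inverse of `1 + A`, `‖A‖ ≤ 1/2`, has norm at most `‖1‖ + 1`. [folklore] -/
theorem norm_inv_oneSub_neg_le {A : 𝔸} (hA : ‖A‖ ≤ 1 / 2) (h1 : ‖-A‖ < 1) :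
    ‖((Units.oneSub (-A) h1)⁻¹ : 𝔸ˣ).val‖ ≤ ‖(1 : 𝔸)‖ + 1 := by
  have h := tsum_geometric_le_of_norm_lt_one (-A) h1
  have hle : (1 - ‖-A‖)⁻¹ ≤ 2 := by
    rw [norm_neg]
    rw [inv_le_comm₀ (by linarith) (by norm_num : (0 : ℝ) < 2)]
    linarith
  calc ‖((Units.oneSub (-A) h1)⁻¹ : 𝔸ˣ).val‖ = ‖∑' n : ℕ, (-A) ^ n‖ := rfl
    _ ≤ ‖(1 : 𝔸)‖ - 1 + (1 - ‖-A‖)⁻¹ := h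
    _ ≤ ‖(1 : 𝔸)‖ + 1 := by linarith

variable [FiniteDimensional ℝ 𝔸]

/-- **The tubular chart of a closed linear group.** For a subgroup `H` of the units of a
finite-dimensional real Banach algebra `𝔸`, closed in `𝔸`, with Lie algebra `𝔥` (membership:
`X ∈ 𝔥 ↔ exp(ℝX) ⊆ H`) and a linear complement `𝔨`: the map `Ψ(X, A) = exp X · (1 + A)` on
`𝔥 × 𝔨` is an analytic local diffeomorphism at `0 ↦ 1` with analytic inverse (packaged as an
`OpenPartialHomeomorph` `Φ` with `⇑Φ = Ψ`, a ball `B(0, δ) ⊆ Φ.source` on which `Φ.symm` is analytic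
at `Φ p`), and there is `0 < r < δ`, `r ≤ 1/2`, such that `h(1 + A) = h'(1 + A')` with `h, h' ∈ H`,
`A, A' ∈ 𝔨`, `‖A‖, ‖A'‖ < r` forces `h = h'` and `A = A'` (Hall, Thm. 3.42 and Cor. 3.45: `H` is an
embedded submanifold; here in multiplicative tubular form). [cite: Hall2015, Theorem 3.42 and Corollary 3.45] -/
theorem exists_tubularChart (hH : IsClosed H) (h1 : (1 : 𝔸) ∈ H)
    (hmul : ∀ a ∈ H, ∀ b ∈ H, a * b ∈ H) (hinv : ∀ a ∈ H, ∃ b ∈ H, b * a = 1)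
    (𝔥 𝔨 : Submodule ℝ 𝔸) (h𝔥 : ∀ X : 𝔸, X ∈ 𝔥 ↔ ∀ t : ℝ, exp (t • X) ∈ H) (hc : IsCompl 𝔥 𝔨) :
    ∃ (Φ : OpenPartialHomeomorph (𝔥 × 𝔨) 𝔸) (δ r : ℝ),
      (⇑Φ = fun p : 𝔥 × 𝔨 => exp (p.1 : 𝔸) * (1 + (p.2 : 𝔸))) ∧ 0 < r ∧ r < δ ∧ r ≤ 1 / 2 ∧
      ball (0 : 𝔥 × 𝔨) δ ⊆ Φ.source ∧
      (∀ p ∈ ball (0 : 𝔥 × 𝔨) δ, AnalyticAt ℝ Φ.symm (Φ p)) ∧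
      (∀ h ∈ H, ∀ h' ∈ H, ∀ A ∈ 𝔨, ∀ A' ∈ 𝔨, ‖A‖ < r → ‖A'‖ < r →
        h * (1 + A) = h' * (1 + A') → h = h' ∧ A = A') := by
  set Ψ : 𝔥 × 𝔨 → 𝔸 := fun p => exp (p.1 : 𝔸) * (1 + (p.2 : 𝔸)) with hΨdef
  -- the linear isomorphism `(X, A) ↦ X + A`
  let Λ : (𝔥 × 𝔨) ≃L[ℝ] 𝔸 := (Submodule.prodEquivOfIsCompl 𝔥 𝔨 hc).toContinuousLinearEquiv
  have hΛapply : ∀ p : 𝔥 × 𝔨, Λ p = (p.1 : 𝔸) + (p.2 : 𝔸) := fun p =>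
    Submodule.coe_prodEquivOfIsCompl' 𝔥 𝔨 hc p
  have hΛ : (Λ : (𝔥 × 𝔨) →L[ℝ] 𝔸) = (𝔥.subtypeL.comp (ContinuousLinearMap.fst ℝ 𝔥 𝔨)) +
      (𝔨.subtypeL.comp (ContinuousLinearMap.snd ℝ 𝔥 𝔨)) := by
    ext p <;> simp [hΛapply]
  have hderiv : HasStrictFDerivAt Ψ (Λ : (𝔥 × 𝔨) →L[ℝ] 𝔸) 0 := by
    rw [hΛ]; exact hasStrictFDerivAt_expMulOneAdd 𝔥 𝔨
  set Φ := hderiv.toOpenPartialHomeomorph Ψ with hΦdef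
  have hΦ : ⇑Φ = Ψ := hderiv.toOpenPartialHomeomorph_coe
  have h0 : (0 : 𝔥 × 𝔨) ∈ Φ.source := hderiv.mem_toOpenPartialHomeomorph_source
  -- invertibility of the derivative near `0`
  have hcd : ContDiff ℝ 1 Ψ := contDiff_iff_contDiffAt.2 fun p =>
    (analyticAt_expMulOneAdd 𝔥 𝔨 p).contDiffAt
  have hcont : Continuous fun p : 𝔥 × 𝔨 => fderiv ℝ Ψ p := hcd.continuous_fderiv one_ne_zero
  set W : Set (𝔥 × 𝔨) :=
    (fun p => fderiv ℝ Ψ p) ⁻¹' range ((↑) : ((𝔥 × 𝔨) ≃L[ℝ] 𝔸) → (𝔥 × 𝔨) →L[ℝ] 𝔸) with hWdef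
  have hWopen : IsOpen W := ContinuousLinearEquiv.isOpen.preimage hcont
  have h0W : (0 : 𝔥 × 𝔨) ∈ W := by
    show fderiv ℝ Ψ 0 ∈ range ((↑) : ((𝔥 × 𝔨) ≃L[ℝ] 𝔸) → (𝔥 × 𝔨) →L[ℝ] 𝔸)
    rw [hderiv.hasFDerivAt.fderiv]
    exact ⟨Λ, rfl⟩
  obtain ⟨δ, hδ, hball⟩ : ∃ δ > 0, ball (0 : 𝔥 × 𝔨) δ ⊆ Φ.source ∩ W :=
    Metric.isOpen_iff.1 (Φ.open_source.inter hWopen) 0 ⟨h0, h0W⟩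
  -- analyticity of the inverse on the image of the ball
  have hsymm : ∀ p ∈ ball (0 : 𝔥 × 𝔨) δ, AnalyticAt ℝ Φ.symm (Φ p) := by
    intro p hp
    obtain ⟨i, hi⟩ := (hball hp).2
    have hi' : fderiv ℝ Φ p = (i : (𝔥 × 𝔨) →L[ℝ] 𝔸) := by rw [hΦ]; exact hi.symm
    exact Φ.analyticAt_symm' (hball hp).1 (by rw [hΦ]; exact analyticAt_expMulOneAdd 𝔥 𝔨 p) hi'
  -- the exponential chart of `H` and the radius `r`
  obtain ⟨r₀, hr₀, hchart⟩ := exists_exp_chart_of_isClosed hH h1 hmul hinv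
  set C₁ : ℝ := ‖(1 : 𝔸)‖ + 1 with hC₁
  have hC₁1 : 1 ≤ C₁ := by rw [hC₁]; linarith [norm_nonneg (1 : 𝔸)]
  set m₀ : ℝ := min 1 (min δ r₀) with hm₀
  have hm₀pos : 0 < m₀ := lt_min one_pos (lt_min hδ hr₀)
  have hm₀1 : m₀ ≤ 1 := min_le_left _ _
  have hm₀δ : m₀ ≤ δ := (min_le_right _ _).trans (min_le_left _ _)
  have hm₀r : m₀ ≤ r₀ := (min_le_right _ _).trans (min_le_right _ _)
  set r : ℝ := m₀ / (8 * (C₁ + 1)) with hr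
  have h8 : (0 : ℝ) < 8 * (C₁ + 1) := by positivity
  have hrpos : 0 < r := div_pos hm₀pos h8
  have hrm : r ≤ m₀ / 8 :=
    div_le_div_of_nonneg_left hm₀pos.le (by norm_num) (by nlinarith)
  have hrδ : r < δ := by linarith
  have hr2 : r ≤ 1 / 2 := by linarith
  have hrC : 2 * r * (C₁ + 1) = m₀ / 4 := by rw [hr]; field_simp; ring
  refine ⟨Φ, δ, r, hΦ, hrpos, hrδ, hr2, fun p hp => (hball hp).1, hsymm, ?_⟩
  -- uniqueness of the representation `h (1 + A)`
  intro h hh h' hh' A hA A' hA' hAr hA'r heq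
  obtain ⟨b, hb, hbh'⟩ := hinv h' hh'
  set u : 𝔸 := b * h with hudef
  have hu : u ∈ H := hmul b hb h hh
  have hu1 : u * (1 + A) = 1 + A' := by
    calc u * (1 + A) = b * (h * (1 + A)) := by rw [hudef, mul_assoc]
      _ = b * (h' * (1 + A')) := by rw [heq]
      _ = 1 + A' := by rw [← mul_assoc, hbh', one_mul]
  -- `‖u - 1‖ < r₀`
  have hnA : ‖-A‖ < 1 := by rw [norm_neg]; linarith
  set v : 𝔸ˣ := Units.oneSub (-A) hnA with hvdef
  have hv : (v : 𝔸) = 1 + A := by rw [hvdef]; simp [Units.oneSub]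
  have hvinv := norm_inv_oneSub_neg_le (hAr.le.trans hr2) hnA
  have hu_eq : u = (1 + A') * (v⁻¹ : 𝔸ˣ).val := by
    rw [← hu1, mul_assoc, ← hv, Units.mul_inv, mul_one]
  have hu_sub : u - 1 = (A' - A) * (v⁻¹ : 𝔸ˣ).val := by
    have h1v : (1 : 𝔸) = (v : 𝔸) * (v⁻¹ : 𝔸ˣ).val := by rw [Units.mul_inv]
    calc u - 1 = (1 + A') * (v⁻¹ : 𝔸ˣ).val - (v : 𝔸) * (v⁻¹ : 𝔸ˣ).val := by rw [hu_eq, ← h1v]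
      _ = ((1 + A') - (1 + A)) * (v⁻¹ : 𝔸ˣ).val := by rw [hv, sub_mul]
      _ = (A' - A) * (v⁻¹ : 𝔸ˣ).val := by congr 1; abel
  have hu_norm : ‖u - 1‖ < m₀ / 4 := by
    calc ‖u - 1‖ = ‖(A' - A) * (v⁻¹ : 𝔸ˣ).val‖ := by rw [hu_sub]
      _ ≤ ‖A' - A‖ * ‖(v⁻¹ : 𝔸ˣ).val‖ := norm_mul_le _ _
      _ ≤ (‖A'‖ + ‖A‖) * C₁ :=
          mul_le_mul (norm_sub_le _ _) hvinv (norm_nonneg _) (by positivity)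
      _ < (r + r) * (C₁ + 1) := by
          have : (‖A'‖ + ‖A‖) * C₁ ≤ (‖A'‖ + ‖A‖) * (C₁ + 1) := by
            apply mul_le_mul_of_nonneg_left (by linarith) (by positivity)
          refine this.trans_lt ?_
          exact mul_lt_mul_of_pos_right (add_lt_add hA'r hAr) (by positivity)
      _ = m₀ / 4 := by rw [← hrC]; ring
  have hu_r₀ : ‖u - 1‖ < r₀ := by linarith
  obtain ⟨X, hXH, hXu, hXn⟩ := hchart u hu hu_r₀
  have hX𝔥 : X ∈ 𝔥 := (h𝔥 X).2 hXH
  -- both representations lie in the chart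
  set p₁ : 𝔥 × 𝔨 := (⟨X, hX𝔥⟩, ⟨A, hA⟩) with hp₁
  set p₂ : 𝔥 × 𝔨 := (0, ⟨A', hA'⟩) with hp₂
  have hXδ : ‖X‖ < δ := by linarith
  have hp₁b : p₁ ∈ ball (0 : 𝔥 × 𝔨) δ := by
    rw [mem_ball_zero_iff, hp₁, Prod.norm_mk, max_lt_iff]
    exact ⟨by simpa using hXδ, by simpa using hAr.trans hrδ⟩
  have hp₂b : p₂ ∈ ball (0 : 𝔥 × 𝔨) δ := by
    rw [mem_ball_zero_iff, hp₂, Prod.norm_mk, max_lt_iff]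
    exact ⟨by simpa using hδ, by simpa using hA'r.trans hrδ⟩
  have hΨeq : Φ p₁ = Φ p₂ := by
    rw [hΦ]
    simp only [hΨdef, hp₁, hp₂, ZeroMemClass.coe_zero, exp_zero, one_mul]
    rw [hXu, hu1]
  have hpeq : p₁ = p₂ := Φ.injOn (hball hp₁b).1 (hball hp₂b).1 hΨeq
  have hX0 : X = 0 := by
    have := congrArg (fun p : 𝔥 × 𝔨 => (p.1 : 𝔸)) hpeq
    simpa [hp₁, hp₂] using this
  have hAA' : A = A' := by
    have := congrArg (fun p : 𝔥 × 𝔨 => (p.2 : 𝔸)) hpeq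
    simpa [hp₁, hp₂] using this
  have hu_one : u = 1 := by rw [← hXu, hX0, exp_zero]
  have hh'b : h' * b = 1 := mul_eq_one_comm_of_mem hinv hb hbh'
  refine ⟨?_, hAA'⟩
  calc h = (h' * b) * h := by rw [hh'b, one_mul]
    _ = h' * u := by rw [hudef, mul_assoc]
    _ = h' := by rw [hu_one, mul_one]

end Main

end Literature.Analysis.Calculus

end
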